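import Mathlib
import HarnessLib
import Summits.QuantumFields.YangMills.Theses.ComplexCouplingChannel
import Summits.QuantumFields.YangMills.Theses.ConvexGribovBody
import Summits.QuantumFields.YangMills.Theses.SmallCircleAnchor
import Summits.QuantumFields.YangMills.Theses.HyperbolicRegulator
import Summits.QuantumFields.YangMills.Theses.ContractibleFibre
import Summits.QuantumFields.YangMills.Theses.DoublingDefect
import Summits.QuantumFields.YangMills.Theses.NoiseSynchronisation
import Summits.QuantumFields.YangMills.Theses.DirichletWindow
import Summits.QuantumFields.YangMills.Theorems.ComplexCouplingChannelContinuumLegGivenGapSplit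
import Summits.QuantumFields.YangMills.Theorems.ConvexGribovBodyContinuumLegGivenGapSelectionRule
import Summits.QuantumFields.YangMills.Theorems.ConvexGribovBodyContinuumLegGivenGapStubWindowOfNG
import Summits.QuantumFields.YangMills.Theorems.ContinuumLegGivenGap.Negative.SkewWindowTwin
import Summits.QuantumFields.YangMills.Theorems.ContinuumLegGivenGap.Negative.PerGroupBurdenWeak
import Summits.QuantumFields.YangMills.Theorems.ContinuumLegGivenGap.Negative.WeakCouplingDelta
import Literature.Barriers.QuantumFields.UVStabilityNonUniqueness
import Literature.MathematicalPhysics.QuantumFieldTheory.MassGapFromLatticeClustering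
import Literature.MathematicalPhysics.QuantumFieldTheory.KallenLehmannPositivity
import Literature.Analysis.FunctionSpaces.SchwartzTranslationAverage
import Summits.QuantumFields.YangMills.Theorems.ComplexCouplingChannelContinuumLegGivenGapStubRotationToAxis
import Summits.QuantumFields.YangMills.Theorems.ComplexCouplingChannelContinuumLegGivenGapStubApproxIdentity
import Summits.QuantumFields.YangMills.Theorems.ComplexCouplingChannelContinuumLegGivenGapStubNonnegSeparated
import Summits.QuantumFields.YangMills.Theorems.ComplexCouplingChannelContinuumLegGivenGapStubBumpPairPositivity
import Summits.QuantumFields.YangMills.Theorems.ComplexCouplingChannelContinuumLegGivenGapStubKLSepOf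
import Summits.QuantumFields.YangMills.Theorems.ComplexCouplingChannelContinuumLegGivenGapKLSepTwoPointFloor

/-!
# Line `duality-selection-nlo-skewness` — skeleton for crux `ContinuumLegGivenGap` (stmt-QuantumFields-15828)

Crux (shared by routes ComplexCouplingChannel / ConvexGribovBody / SmallCircleAnchor / HyperbolicRegulator /
ContractibleFibre (`WeakCouplingContinuumLeg`) / DoublingDefect / NoiseSynchronisation — character-identical
declarations): for every compact simple `G` (Borel σ-algebra), the per-β volume-uniform weak-coupling torus
clustering in every faithful `r` (`GapHyp`) implies the re-typed `YangMills` existential for `G`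
(`∃ r sch T, sch.HasWeakCouplingLimit ∧ IsYangMillsFor r sch T ∧ T.IsNontrivial r.curvature ∧
T.IsNonGaussian r.curvature ∧ ∃ Δ > 0, T.HasMassGap Δ ∧ HasLatticeMassGap r sch Δ`).

## The idea (card `Ideas/duality-selection-nlo-skewness.md`, triage r1-1/r1-2: pass/pass)

Electric–magnetic duality makes free glue CUBICALLY GAUSSIAN for the Clay species: the free curvature
propagator anticommutes with the Hodge star, so the tree-level (order `g⁶`) connected three-point function of the
six-plane action density `r.curvature` vanishes identically off the diagonal (LANDED:
`Summit.QuantumFields.YangMills.Theorems.ContinuumLegGivenGap.trace_twoForm_triple_eq_zero`, `stub_hodgeSelection`).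
Hence the `IsNonGaussian r.curvature` witness of this crux is a NEXT-TO-LEADING-ORDER effect, and in the
renormalisation-group-invariant currency of the canonically normalised (`c_k = a_k⁻⁴`), exactly centred lattice
functional `curvDistribution r sch k n` it takes the form of a **quartic skewness law** at short physical scale `ε`:

  `κ₃(F₃^ε) = s · κ₂(F₂^ε)² · (1 + o(1))`  as `ε → 0⁺`, eventually in `k` along a subsequence, with `s ≠ 0`,

because `κ₂(F₂^ε) ≍ A g⁴(ε)` (two-point function of `g₀² tr F²`, RG-invariant to leading order) and
`κ₃(F₃^ε) ≍ g⁶(ε)·0 + g⁸(ε)·s'` (tree `≡ 0` by duality selection; `s'` = the one-loop coefficient, card K2), so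
`κ₃/κ₂² → s := s'/A²` — the scale `Λ` and the running coupling drop out of the statement (no `w_j`, no `c_curv`
bookkeeping: triage r1-2 sharpening 1), and the tree term's absence is encoded in the EXPONENT (with a tree term,
`κ₃/κ₂² ∼ g⁻²(ε) → ∞`). Combined with strict positivity of the two-point function at every short scale
(Källén–Lehmann for the OS limit, non-trivial by (ND)), ONE small `ε` gives a three-point floor, i.e. the (NG)
input that line `Sketch`'s landed glue turns into the crux.

## Shape (3 registered stubs + PROVED glue; `XiDiverges` = stmt-QuantumFields-8941 BY NAME as in line `Sketch`)

* `stub_uvPackageVol` — SHARED VERBATIM with line `Sketch` (child `VolumeUniformUVEngine`; open-problem class): the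
  volume-uniform UV engine at the gap-pinned unit ((UUVB) ∧ (ND) ∧ (ROT₃₄₅) for every canonical centred admissible
  scheme). Untouched by this line; consumed through the landed `cclgSplit_uvPackage_exists`.
* `stub_quarticSkewnessLaw` — NEW, the card's K1 ∧ K2 in RG-invariant form (child `SkewnessWindowNLO` re-typed):
  for every weak-coupling scheme carrying the package of line `Sketch` ((UUVB), (ND), (UCL), (PVG), E1 halves,
  lattice gap, CS clustering) there are sup-normalised DILATION families of admissible tensors `F₃^ε = (f⊗g⊗h)^ε`,
  `F₂^ε = (f₂⊗g₂)^ε` (`f₂, g₂ ≥ 0` real, non-zero), `s > 0` and a subsequence `φ` with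
  `|‖κ₃(F₃^ε)‖ − s‖κ₂(F₂^ε)‖²| ≤ η‖κ₂(F₂^ε)‖²` for all `ε ≤ ε₁(η)`, eventually in `k` along `φ`. LOAD-BEARING.
* `stub_twoPointPositivity` — NEW (OS-theory class, Källén–Lehmann): for every such scheme and every admissible
  non-negative real pure pair `f ⊗ g` (both factors non-zero) the canonical two-point functional is bounded away
  from `0` eventually in `k` (every subsequential OS limit is a non-trivial RP scalar theory, whose Schwinger
  two-point function is a non-zero superposition of free propagators, hence `> 0` pointwise off the diagonal;
  compactness upgrades the per-limit positivity to an eventual lattice floor).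
* PROVED here: `floor_of_quarticLaw` (B ∧ C ⇒ the skewness floor FREQUENTLY, pure filter logic: `η := s/2`, one
  `ε`, floor `δ := (s/2)u²`), `concl_of_stubs` (line `Sketch`'s landed def-free composition
  `cclgSplit_*` / `stub_critical` / `stub_extract` / `oneFieldOSLegs'` / `hasMassGap_of_hasCSClustering` with the
  skewness-window hypothesis REPLACED by stubs B ∧ C), and `ContinuumLegGivenGap_of` (+ six by-name twins).

## Reshape a3-1 (lead a3, `prover-line-stmt-QuantumFields-15828-a3-0`, 2026-08-17; concurrent lead c14 drives the arrays line)
* K2 of `stub_quarticSkewnessLaw` is SETTLED POSITIVELY at the desk (`Lines/duality-selection-K2.md`, item evidence): the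
  O(g²) separated-point coefficient of `⟨trF² trF² trF²⟩` is non-zero for every compact simple `G` — free OPE `F²×F²`
  contains the stress tensor with coefficient `−32/π²` (Ward identity) and `⟨T_ab F²⟩ = α(δ_ab − (8/5)ŷ_aŷ_b)/y⁸` at
  O(g²) with `α ∝ b₀ dimG ≠ 0` (trace anomaly + conservation) ⇒ an anisotropic non-vanishing leading `x₁ → x₂`
  asymptotics (`∝ b₀ dimG sin²φ`); it vanishes iff `b₀ = 0` (abelian), as `crux_false_without_nonabelian` demands. So
  the bet's open content is K1 only (NLO accuracy of a volume-uniform UV engine — child-2 class, said plainly).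
* `stub_twoPointPositivity` is no longer a stub: it is DERIVED from two registered stubs — `stub_KL`, the Literature
  named fact `KallenLehmannPositivity` (p159699 ACCEPTED 12:12Z, commit 1868f1e3; Glimm–Jaffe Thm. 6.2.4, Reed–Simon II IX.34, OS
  E→R — published, not provable in the E1-free reconstruction the tree has), and `stub_twoPointOfKL` (PROVED below:
  compactness via `extraction_forall_of_frequently`, `cclgSplit_pt_package_subScheme`, `exists_limitFunctionals`,
  `LimitPkg.osData/isNontrivial/Λ_one`, `zeroExt_curv`). Sorries now: `stub_uvPackageVol` (child 2, shared),
  `stub_quarticSkewnessLaw` (K1), `stub_KL` (named fact) — 3.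
* Registration is ADDITIVE (`ledger workitem stub-add`), never `skeleton check --crux`, so as not to deactivate the
  arrays line's stubs (one registry per crux item; `Lines/COORDINATION-a3.md`).

## Reshape c15-1 (lead c15, `prover-line-stmt-QuantumFields-15828-c15-0`, 2026-08-17T19:00Z; a3's seat ended 12:46Z, c14's 14:41Z)
* The Källén–Lehmann input is RE-CUT in the form the composition consumes — SEPARATED supports (`KLSep`): the bet
  `stub_quarticSkewnessLawSep` now also promises `dist(tsupport f₂^ε, tsupport g₂^ε) > 0` (free for a dilation family of
  disjointly supported profiles), `floor_of_quarticLaw` threads it, `stub_twoPointOfKLSep` is a3's compactness proof verbatim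
  with the extra hypothesis, and `KLSep` is DERIVED from four worker stubs (`stub_rotationToAxis`, `stub_approxIdentity`,
  `stub_bumpPairPositivity`, `stub_nonnegSeparated`) and the lead's `stub_KLSep_of` — all of them provable in the tree NOW
  (engine: `SchwartzExchange`, `SchwartzTranslationAverage.integral_mul_apply_compSubConstCLM`, `SchwartzTranslationCutoff`,
  `continuous_tensorFin`, `OSReconstructionNoE1` + `OSTimeAxisNullVector`). Blueprint: `Lines/duality-selection-KL-blueprint.md`.
* Sorries: `stub_uvPackageVol` (child 2, shared, open), `stub_quarticSkewnessLawSep` (bet; K1 open, K2 passed), and the five KL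
  pieces (landable) — 7 = stubs_max. Phase 2 (unregistered): cutoff step ⇒ `KallenLehmannPositivity_holds` (p159699) itself, after
  which a3's `stub_twoPointOfKL` (p160173) is unconditional and the original cut is restored as a corollary.

## Reshape c15-4 (lead c15, 22:15Z): the KL leg is a THEOREM of the tree
* All five KL pieces LANDED: `stub_rotationToAxis` p172758, `stub_approxIdentity` p172773, `stub_nonnegSeparated` p172995,
  `stub_bumpPairPositivity` p173789 (content `BumpPair.positivity_dichotomy` p173496), `stub_KLSep_of` p173829 (helpers KLSepRadialBump
  p172840, KLSepDictionary p173013, KLSepStrict p173247). Hence `klSep` (Källén–Lehmann positivity on separated supports, general OS data,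
  every `d ≥ 1`), `stub_twoPointOfKLSep` and `stub_twoPointPositivitySep` below are sorry-free. Sorries: `stub_uvPackageVol` (child 2, shared,
  open-problem class), `stub_quarticSkewnessLawSep` (the bet; K1 open, K2 passed) — 2.

## Disproof / Negative lemmas honoured (imported below so the scratch check sees them)
* `Disproof.lean` gen 2 §2 `crux_false_without_nonabelian`: stub B's `s > 0` is the non-abelian input
  (`s' ∝ C₂(adj)`; for `U(1)`/`PUnit` free Maxwell is exactly cubically Gaussian and B fails, as it must);
  `crux_false_without_linear`: `r` comes from `IsCompactSimpleLieGroup` via `stub_uvPackageVol`, unchanged;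
  §2 MORAL (all content in `IsNontrivial ∧ IsNonGaussian` at the pinned unit): B/C attack exactly `IsNonGaussian`,
  `IsNontrivial` rides on (ND) of the UV package; §3/§4 (rate sacrifice, SHARP lock): untouched, the landed 17-RP
  lock is reused verbatim.
* `Negative/SkewWindowTwin` (`stub_skewWindowFullSeqFalse`, `skewWindowSubseq_twin_stable`): the quartic law has
  weight `3 ≠ 4` under `c_k ↦ λ_k c_k`, so it is meaningful ONLY at canonical normalisation — it is stated over
  `curvDistribution` ((CAN) built in, twins excluded by the type) and SUBSEQUENTIALLY in `k`.
* `Negative/PerGroupBurdenWeak`, `Negative/WeakCouplingDelta`: no stub instantiates a refuted shape (no free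
  spacings, no bounded couplings: `β_k → ∞` is a hypothesis of B and C).
-/

noncomputable section

namespace Summit.QuantumFields.YangMills.Cruxes.ContinuumLegGivenGap.DualitySelectionNloSkewness

open scoped SchwartzMap
open Filter Topology MeasureTheory
open Literature.MathematicalPhysics.QuantumFieldTheory Literature.MathematicalPhysics.QuantumLattice
  Literature.MathematicalPhysics.AQFT Literature.Probability.LatticeModels
open Literature.Barriers.QuantumFields (subScheme hasLatticeMassGap_subScheme)
open Summit.QuantumFields.YangMills.Theses
open Summit.QuantumFields.YangMills.Cruxes.ContinuumLimitOnTrajectory.TwoOrbitSynchronisation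
  (curvDistribution canon UUVB ND2 ND3 UCL PolyVolumeGrowth AsympTransl AsympRot oneFieldOSLegs' LimitPkg
   exists_limitFunctionals zeroExt zeroExt_curv)
open Summit.QuantumFields.YangMills.Theorems.ContinuumLegGivenGap
  (cclgSplit_uvPackage_exists cclgSplit_locked_of_core cclgSplit_gap_of_locked cclgSplit_pt_package_subScheme
   cclgSplit_min_pos cclgSplit_hasLatticeMassGap_mono cclgSplit_hasCSClustering_mono
   cclgSplit_hasCSClustering_canon_subScheme stub_critical stub_extract)

local notation "𝔼" => EuclideanSpace ℝ (Fin 4)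

/-! ## §1 Registered stubs (`theorem stub_… := by sorry`; self-contained signatures over tree declarations) -/

/-- `stub_uvPackageVol` — **the volume-uniform UV engine at the intrinsic unit** (SHARED VERBATIM with line `Sketch`,
reshape 17; child `VolumeUniformUVEngine`; Bałaban / Magnen–Rivasseau–Sénéor class, open): at some faithful `r`, for
every locked critical IR datum (`β_k → ∞`, `m̂_k > 0`, thresholds, `K > 0`; UNIFORM ∧ SHARP; `m̂ → 0`) the engine returns
spacings `Δ₀ a_k ≤ m̂_{φ k}`, unbounded admissible torus sets `𝓛 k` above the IR thresholds of polynomial volume growth,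
and for EVERY canonically normalised exactly centred scheme on them: (UUVB) uniform-threshold E0′ bounds for all
corner-plaquette strings, (ND) a two-point floor on a time-ordered OS pair, (ROT₃₄₅) asymptotic invariance under the
Pythagorean rotation of the `(x⁰,x¹)`-plane. This line does not touch it. [folklore] -/
theorem stub_uvPackageVol :
    ∀ (G : Type) [Group G] [TopologicalSpace G] [IsTopologicalGroup G] [CompactSpace G]
      [MeasurableSpace G] [BorelSpace G], IsCompactSimpleLieGroup G → ∃ r : LatticeRep G,
      ∀ (β : ℕ → ℝ) (mh : ℕ → ℝ) (S₁ : ℕ → ℕ) (K : ℝ), Tendsto β atTop atTop → (∀ k, 0 < mh k) → 0 < K →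
      (∀ A B : YMSpecies G, ∃ C : ℝ, ∀ k S n : ℕ, S₁ k ≤ S → n ≤ S →
        |latticeConnectedCorr r.ρ (β k) (2 * S + 1) A.F B.F n| ≤ C * Real.exp (-(mh k * n))) →
      (∀ k S₀ : ℕ, ∃ A B : YMSpecies G, ∀ C : ℝ, ∃ S n : ℕ, S₀ ≤ S ∧ n ≤ S ∧
        C * Real.exp (-(K * mh k * n)) < |latticeConnectedCorr r.ρ (β k) (2 * S + 1) A.F B.F n|) →
      Tendsto mh atTop (𝓝 0) →
      ∃ (a : ℕ → ℝ) (φ : ℕ → ℕ) (Δ₀ : ℝ) (𝓛 : ℕ → Set ℕ),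
        (∀ k, 0 < a k) ∧ StrictMono φ ∧ 0 < Δ₀ ∧ (∀ k, Δ₀ * a k ≤ mh (φ k)) ∧
        (∀ k S : ℕ, ∃ S' : ℕ, S' ∈ 𝓛 k ∧ S ≤ S') ∧ (∀ k : ℕ, ∀ S ∈ 𝓛 k, S₁ (φ k) ≤ S) ∧
        (∃ N : ℕ, 1 ≤ N ∧ ∀ᶠ k in atTop, ∀ S ∈ 𝓛 k, (a k)⁻¹ ≤ (a k * (S : ℝ)) ^ N) ∧
      ∀ (sch : SpeciesScheme (YMSpecies G)), (∀ k, sch.a k = a k) → (∀ k, sch.β k = β (φ k)) →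
        (∀ k, sch.L k ∈ 𝓛 k) →
      ∀ (LS : (k n : ℕ) → SchwartzMap (Fin n → EuclideanSpace ℝ (Fin 4)) ℂ → ℂ),
      (∀ (k n : ℕ) (F : SchwartzMap (Fin n → EuclideanSpace ℝ (Fin 4)) ℂ), LS k n F =
        ∫ U : GaugeConfig 4 (sch.side k) G, ∑ x : Fin n → ↥(Literature.Probability.LatticeModels.box 4 (sch.L k)),
          F (fun i => sch.a k • siteToE ↑(x i)) *
            ∏ i, ((sch.c r.curvature k * sch.a k ^ 4 *
              (r.curvature.F (Literature.MathematicalPhysics.QuantumLattice.configShift (-↑(x i)) (Literature.MathematicalPhysics.QuantumLattice.torusLift (sch.side k) U)) - sch.m r.curvature k) : ℝ) : ℂ)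
          ∂(wilsonMeasure r.ρ (sch.β k))) →
      (∀ k : ℕ, sch.m r.curvature k =
        ∫ U : GaugeConfig 4 (sch.side k) G, r.curvature.F (Literature.MathematicalPhysics.QuantumLattice.torusLift (sch.side k) U) ∂(wilsonMeasure r.ρ (sch.β k))) →
      (∀ k : ℕ, sch.c r.curvature k = (sch.a k ^ 4)⁻¹) →
      (∃ (s : ℕ) (α β' : ℝ), ∀ᶠ k in atTop, ∀ (p : ℕ) (q : Fin p → {q : Fin 4 × Fin 4 // q.1 < q.2})
        (F : SchwartzMap (Fin p → EuclideanSpace ℝ (Fin 4)) ℂ), IsOffDiagonal F →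
        ‖∫ U : GaugeConfig 4 (sch.side k) G, ∑ x : Fin p → ↥(Literature.Probability.LatticeModels.box 4 (sch.L k)),
            F (fun i => sch.a k • siteToE ↑(x i)) *
              ∏ i, ((plaquetteObs r.ρ 0 (q i).1.1 (q i).1.2 (Literature.MathematicalPhysics.QuantumLattice.configShift (-↑(x i)) (Literature.MathematicalPhysics.QuantumLattice.torusLift (sch.side k) U)) -
                wilsonTorusMean r.ρ (sch.β k) (sch.L k) (plaquetteObs r.ρ 0 (q i).1.1 (q i).1.2) : ℝ) : ℂ)
            ∂(wilsonMeasure r.ρ (sch.β k))‖ ≤ α * (p.factorial : ℝ) ^ β' * schwartzNorm (p * s) F) ∧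
      (∃ (f g : SchwartzMap (Fin 1 → EuclideanSpace ℝ (Fin 4)) ℂ)
        (H : SchwartzMap (Fin (1 + 1) → EuclideanSpace ℝ (Fin 4)) ℂ),
        IsTimeOrdered f ∧ IsTimeOrdered g ∧ IsAppendTensorOf H (osAdjoint f) g ∧
          ∃ δ : ℝ, 0 < δ ∧ ∀ᶠ k in atTop, δ ≤ ‖LS k (1 + 1) H‖) ∧
      (∀ R : EuclideanSpace ℝ (Fin 4) ≃ₗᵢ[ℝ] EuclideanSpace ℝ (Fin 4),
        R (EuclideanSpace.single 0 1) =
          (3 / 5 : ℝ) • EuclideanSpace.single 0 1 + (-(4 / 5) : ℝ) • EuclideanSpace.single 1 1 →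
        R (EuclideanSpace.single 1 1) =
          (4 / 5 : ℝ) • EuclideanSpace.single 0 1 + (3 / 5 : ℝ) • EuclideanSpace.single 1 1 →
        R (EuclideanSpace.single 2 1) = EuclideanSpace.single 2 1 →
        R (EuclideanSpace.single 3 1) = EuclideanSpace.single 3 1 →
        ∀ (n : ℕ) (F : SchwartzMap (Fin n → EuclideanSpace ℝ (Fin 4)) ℂ), IsOffDiagonal F →
          Tendsto (fun k : ℕ => LS k n (linActMulti R F) - LS k n F) atTop (𝓝 0)) := by
  sorry

/-- `stub_quarticSkewnessLawSep` — **the quartic skewness law (reshape c15-1: + separated pair supports)** of the Clay species at short distance** (card K1 ∧ K2 in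
renormalisation-group-invariant form; child `SkewnessWindowNLO` re-typed; open — UV-engine class at SECOND order plus
the one-loop certificate). For a compact simple `G`, a faithful `r` and a weak-coupling scheme `sch` (`β_k → ∞`)
carrying line `Sketch`'s package — (UUVB) uniform E0′ bounds, (ND) a two-point floor, (UCL) spatial clustering, (PVG)
polynomial volume growth, both halves of E1, a volume-uniform lattice gap and Cauchy–Schwarz clustering in OS currency —
there are sup-normalised DILATION families of admissible test tensors, `F₃^ε = (f ⊗ g ⊗ h)^ε ∈ ⁰𝒮₃` and
`F₂^ε = (f₂ ⊗ g₂)^ε ∈ ⁰𝒮₂` with `f₂^ε, g₂^ε ≥ 0` real and non-zero (`φ^ε(x) = φ¹(x/ε)`), a constant `s > 0` and a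
strictly increasing `φ`, such that for every `η > 0` there is `ε₁ > 0` with, for all `0 < ε ≤ ε₁`, EVENTUALLY in `k`:
`|‖κ₃(F₃^ε)‖ − s ‖κ₂(F₂^ε)‖²| ≤ η ‖κ₂(F₂^ε)‖²`, `κₙ := curvDistribution r sch (φ k) n` (canonical `c = a⁻⁴`, exact
centring, so `κ₂, κ₃` ARE the truncated functions). Why quartic: `κ₂(F₂^ε) ≍ A g⁴(ε)` and, the tree triangle of the
six-plane density vanishing identically (landed `trace_twoForm_triple_eq_zero`), `κ₃(F₃^ε) ≍ s' g⁸(ε)` with `s'` the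
scheme-free, log-free one-loop coefficient (card FACT 2), whence `κ₃/κ₂² → s = s'/A²`; `s ≠ 0` is the certificate K2
(`s' ∝ C₂(adj)`: the non-abelian input, cf. `crux_false_without_nonabelian`); the `o(1)` is asymptotic freedom
`g²(ε) → 0` plus NLO accuracy of the engine on composite insertions at separated points (card K1). Normalisation weight
`3 ≠ 4` under `c ↦ λc`: meaningful only at (CAN) (`Negative/SkewWindowTwin`), hence stated over `curvDistribution`
and along a subsequence. The composition consumes only its lower half at ONE `ε`. [folklore] -/
theorem stub_quarticSkewnessLawSep :
    ∀ (G : Type) [Group G] [TopologicalSpace G] [IsTopologicalGroup G] [CompactSpace G]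
      [MeasurableSpace G] [BorelSpace G], IsCompactSimpleLieGroup G →
      ∀ (r : LatticeRep G) (sch : SpeciesScheme (YMSpecies G)),
      Tendsto sch.β atTop atTop → UUVB r sch → ND2 r sch → UCL r sch → PolyVolumeGrowth sch →
      AsympTransl r sch → AsympRot r sch →
      (∃ Δ₀ : ℝ, 0 < Δ₀ ∧ HasLatticeMassGap r sch Δ₀) →
      (∃ Δ₁ : ℝ, 0 < Δ₁ ∧ SpeciesScheme.HasCSClustering r (canon r sch) Δ₁) →
      ∃ (f g h f₂ g₂ : ℝ → SchwartzMap (EuclideanSpace ℝ (Fin 4)) ℂ)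
        (F₃ : ℝ → SchwartzMap (Fin 3 → EuclideanSpace ℝ (Fin 4)) ℂ)
        (F₂ : ℝ → SchwartzMap (Fin 2 → EuclideanSpace ℝ (Fin 4)) ℂ) (s : ℝ) (φ : ℕ → ℕ),
        0 < s ∧ StrictMono φ ∧
        (∀ ε : ℝ, 0 < ε → IsTensorOf (F₃ ε) ![f ε, g ε, h ε] ∧ IsOffDiagonal (F₃ ε) ∧
          IsTensorOf (F₂ ε) ![f₂ ε, g₂ ε] ∧ IsOffDiagonal (F₂ ε)) ∧
        (∀ ε : ℝ, 0 < ε → ∀ x : EuclideanSpace ℝ (Fin 4),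
          f ε x = f 1 (ε⁻¹ • x) ∧ g ε x = g 1 (ε⁻¹ • x) ∧ h ε x = h 1 (ε⁻¹ • x) ∧
            f₂ ε x = f₂ 1 (ε⁻¹ • x) ∧ g₂ ε x = g₂ 1 (ε⁻¹ • x)) ∧
        (∀ ε : ℝ, 0 < ε →
          (∀ x : EuclideanSpace ℝ (Fin 4), (f₂ ε x).im = 0 ∧ 0 ≤ (f₂ ε x).re ∧ (g₂ ε x).im = 0 ∧ 0 ≤ (g₂ ε x).re) ∧
            f₂ ε ≠ 0 ∧ g₂ ε ≠ 0 ∧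
            ∃ δ : ℝ, 0 < δ ∧ ∀ x ∈ tsupport (f₂ ε : EuclideanSpace ℝ (Fin 4) → ℂ),
              ∀ y ∈ tsupport (g₂ ε : EuclideanSpace ℝ (Fin 4) → ℂ), δ ≤ dist x y) ∧
        ∀ η : ℝ, 0 < η → ∃ ε₁ : ℝ, 0 < ε₁ ∧ ∀ ε : ℝ, 0 < ε → ε ≤ ε₁ → ∀ᶠ k in atTop,
          |‖curvDistribution r sch (φ k) 3 (F₃ ε)‖ - s * ‖curvDistribution r sch (φ k) 2 (F₂ ε)‖ ^ 2| ≤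
            η * ‖curvDistribution r sch (φ k) 2 (F₂ ε)‖ ^ 2 := by
  sorry

/-! ### Reshape c15-1 (lead c15, 2026-08-17): the Källén–Lehmann input in SEPARATED-SUPPORT form, decomposed

The composition consumes two-point positivity only on pairs with DISJOINT (indeed separated) supports (the bet is
free to choose such pair profiles; dilation preserves separation). `KLSep` below is that statement for general OS
data; it is PROVED (Euclidean-ly: E0′ continuity, E1, E2, E3 and the tree's E1-free reconstruction) through four
registered analytic/OS stubs and the lead's `stub_KLSep_of`. Phase 2 (not registered): the cutoff step from
separated supports to `f ⊗ g ∈ ⁰𝒮`, i.e. `KallenLehmannPositivity_holds` (p159699) itself. -/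

-- `stub_rotationToAxis`: LANDED (p172758, Theorems/ComplexCouplingChannelContinuumLegGivenGapStubRotationToAxis.lean) — imported by name from `Theorems/`; registered signature unchanged.

-- `stub_approxIdentity`: LANDED (p172773, Theorems/ComplexCouplingChannelContinuumLegGivenGapStubApproxIdentity.lean) — imported by name from `Theorems/`; registered signature unchanged.

-- `stub_bumpPairPositivity`: LANDED (p173789, Theorems/ComplexCouplingChannelContinuumLegGivenGapStubBumpPairPositivity.lean; content BumpPair.positivity_dichotomy p173496) — imported by name from `Theorems/`; registered signature unchanged.

-- `stub_nonnegSeparated`: LANDED (p172995, Theorems/ComplexCouplingChannelContinuumLegGivenGapStubNonnegSeparated.lean) — imported by name from `Theorems/`; registered signature unchanged.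

-- `stub_KLSep_of`: LANDED (p173829, Theorems/ComplexCouplingChannelContinuumLegGivenGapStubKLSepOf.lean) — imported by name from `Theorems/`; registered signature unchanged.

-- `klSep`: LANDED (p173971, Theorems/ComplexCouplingChannelContinuumLegGivenGapKLSepTwoPointFloor.lean) — imported by name from `Theorems/`.
-- `stub_twoPointOfKLSep`: LANDED (p173971) — imported by name from `Theorems/`.
-- `stub_twoPointPositivitySep`: LANDED (p173971) — imported by name from `Theorems/`.
/-! ## §2 Glue (PROVED): the skewness floor from the quartic law and two-point positivity -/

/-- **The card's first lemma in quartic-law form** (pure filter logic over an ABSTRACT family of functionals `D k n`):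
a quartic law along `φ` with `s > 0` (hypothesis shape of `stub_quarticSkewnessLaw`'s conclusion) and two-point floors
for non-negative admissible pairs (shape of `stub_twoPointPositivity`'s conclusion) give ONE admissible triple tensor
and `δ > 0` with `δ ≤ ‖D k 3 F₃‖` frequently in `k` — take `η := s/2`, the scale `ε := ε₁(η)`, the floor `u` of the
pair at that scale, `δ := (s/2)·u²`. [folklore] -/
theorem floor_of_quarticLaw (D : (k n : ℕ) → SchwartzMap (Fin n → 𝔼) ℂ → ℂ)
    (hQ : ∃ (f g h f₂ g₂ : ℝ → SchwartzMap 𝔼 ℂ)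
        (F₃ : ℝ → SchwartzMap (Fin 3 → 𝔼) ℂ)
        (F₂ : ℝ → SchwartzMap (Fin 2 → 𝔼) ℂ) (s : ℝ) (φ : ℕ → ℕ),
        0 < s ∧ StrictMono φ ∧
        (∀ ε : ℝ, 0 < ε → IsTensorOf (F₃ ε) ![f ε, g ε, h ε] ∧ IsOffDiagonal (F₃ ε) ∧
          IsTensorOf (F₂ ε) ![f₂ ε, g₂ ε] ∧ IsOffDiagonal (F₂ ε)) ∧
        (∀ ε : ℝ, 0 < ε → ∀ x : 𝔼,
          f ε x = f 1 (ε⁻¹ • x) ∧ g ε x = g 1 (ε⁻¹ • x) ∧ h ε x = h 1 (ε⁻¹ • x) ∧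
            f₂ ε x = f₂ 1 (ε⁻¹ • x) ∧ g₂ ε x = g₂ 1 (ε⁻¹ • x)) ∧
        (∀ ε : ℝ, 0 < ε →
          (∀ x : 𝔼, (f₂ ε x).im = 0 ∧ 0 ≤ (f₂ ε x).re ∧ (g₂ ε x).im = 0 ∧ 0 ≤ (g₂ ε x).re) ∧
            f₂ ε ≠ 0 ∧ g₂ ε ≠ 0 ∧
            ∃ δ : ℝ, 0 < δ ∧ ∀ x ∈ tsupport (f₂ ε : EuclideanSpace ℝ (Fin 4) → ℂ),
              ∀ y ∈ tsupport (g₂ ε : EuclideanSpace ℝ (Fin 4) → ℂ), δ ≤ dist x y) ∧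
        ∀ η : ℝ, 0 < η → ∃ ε₁ : ℝ, 0 < ε₁ ∧ ∀ ε : ℝ, 0 < ε → ε ≤ ε₁ → ∀ᶠ k in atTop,
          |‖D (φ k) 3 (F₃ ε)‖ - s * ‖D (φ k) 2 (F₂ ε)‖ ^ 2| ≤ η * ‖D (φ k) 2 (F₂ ε)‖ ^ 2)
    (hP : ∀ (f g : SchwartzMap 𝔼 ℂ) (F₂ : SchwartzMap (Fin 2 → 𝔼) ℂ),
        IsTensorOf F₂ ![f, g] → IsOffDiagonal F₂ →
        (∀ x : 𝔼, (f x).im = 0 ∧ 0 ≤ (f x).re ∧ (g x).im = 0 ∧ 0 ≤ (g x).re) → f ≠ 0 → g ≠ 0 →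
        (∃ δ : ℝ, 0 < δ ∧ ∀ x ∈ tsupport (f : 𝔼 → ℂ), ∀ y ∈ tsupport (g : 𝔼 → ℂ), δ ≤ dist x y) →
        ∃ u : ℝ, 0 < u ∧ ∀ᶠ k in atTop, u ≤ ‖D k 2 F₂‖) :
    ∃ (f g h : SchwartzMap 𝔼 ℂ) (F₃ : SchwartzMap (Fin 3 → 𝔼) ℂ),
      IsTensorOf F₃ ![f, g, h] ∧ IsOffDiagonal F₃ ∧ ∃ δ : ℝ, 0 < δ ∧ ∃ᶠ k in atTop, δ ≤ ‖D k 3 F₃‖ := by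
  obtain ⟨f, g, h, f₂, g₂, F₃, F₂, s, φ, hs, hφ, hadm, -, hsgn, hlaw⟩ := hQ
  obtain ⟨ε₁, hε₁, hlaw₁⟩ := hlaw (s / 2) (half_pos hs)
  obtain ⟨hT₃, hO₃, hT₂, hO₂⟩ := hadm ε₁ hε₁
  obtain ⟨hsg, hf0, hg0, hsep⟩ := hsgn ε₁ hε₁
  obtain ⟨u, hu, hfloor⟩ := hP (f₂ ε₁) (g₂ ε₁) (F₂ ε₁) hT₂ hO₂ hsg hf0 hg0 hsep
  have hlawε : ∀ᶠ k in atTop, |‖D (φ k) 3 (F₃ ε₁)‖ - s * ‖D (φ k) 2 (F₂ ε₁)‖ ^ 2| ≤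
      s / 2 * ‖D (φ k) 2 (F₂ ε₁)‖ ^ 2 := hlaw₁ ε₁ hε₁ le_rfl
  have hfloorφ : ∀ᶠ k in atTop, u ≤ ‖D (φ k) 2 (F₂ ε₁)‖ := hφ.tendsto_atTop.eventually hfloor
  refine ⟨f ε₁, g ε₁, h ε₁, F₃ ε₁, hT₃, hO₃, s / 2 * u ^ 2, by positivity, ?_⟩
  have hev : ∀ᶠ k in atTop, s / 2 * u ^ 2 ≤ ‖D (φ k) 3 (F₃ ε₁)‖ := by
    filter_upwards [hlawε, hfloorφ] with k hk hk'
    have hb : u ^ 2 ≤ ‖D (φ k) 2 (F₂ ε₁)‖ ^ 2 := pow_le_pow_left₀ hu.le hk' 2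
    have h1 := (abs_sub_le_iff.1 hk).2
    nlinarith [h1, hb, hs]
  exact hφ.tendsto_atTop.frequently (p := fun n => s / 2 * u ^ 2 ≤ ‖D n 3 (F₃ ε₁)‖) hev.frequently

/-! ## §3 The composition at one gauge group (line `Sketch`'s landed def-free glue, skewness input replaced) -/

variable {G : Type} [Group G] [TopologicalSpace G] [IsTopologicalGroup G] [CompactSpace G]

/-- **The composition at one `G`**: under `XiDiverges`, the UV-engine statement (A), the quartic skewness law (B)
and two-point positivity (C), the crux's per-β torus clustering at every faithful `r` of a compact simple `G` (Borel
σ-algebra) yields the re-typed `YangMills` existential for `G`. Verbatim `cclgSplit_concl` (landed, p145379 family)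
except that the skewness floor now comes from `floor_of_quarticLaw` fed with (B) and (C) at the canonical scheme
`sch` delivered by (A) — all its hypotheses ((UUVB), (ND), (UCL), (PVG), E1 halves, lattice gap, CS clustering) are
in hand at that point. [folklore] -/
theorem concl_of_stubs [MeasurableSpace G] [BorelSpace G] (hXi : DirichletWindow.XiDiverges)
    (hUV : (∀ (G : Type) [Group G] [TopologicalSpace G] [IsTopologicalGroup G] [CompactSpace G]
      [MeasurableSpace G] [BorelSpace G], IsCompactSimpleLieGroup G → ∃ r : LatticeRep G,
      ∀ (β : ℕ → ℝ) (mh : ℕ → ℝ) (S₁ : ℕ → ℕ) (K : ℝ), Tendsto β atTop atTop → (∀ k, 0 < mh k) → 0 < K →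
      (∀ A B : YMSpecies G, ∃ C : ℝ, ∀ k S n : ℕ, S₁ k ≤ S → n ≤ S →
        |latticeConnectedCorr r.ρ (β k) (2 * S + 1) A.F B.F n| ≤ C * Real.exp (-(mh k * n))) →
      (∀ k S₀ : ℕ, ∃ A B : YMSpecies G, ∀ C : ℝ, ∃ S n : ℕ, S₀ ≤ S ∧ n ≤ S ∧
        C * Real.exp (-(K * mh k * n)) < |latticeConnectedCorr r.ρ (β k) (2 * S + 1) A.F B.F n|) →
      Tendsto mh atTop (𝓝 0) →
      ∃ (a : ℕ → ℝ) (φ : ℕ → ℕ) (Δ₀ : ℝ) (𝓛 : ℕ → Set ℕ),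
        (∀ k, 0 < a k) ∧ StrictMono φ ∧ 0 < Δ₀ ∧ (∀ k, Δ₀ * a k ≤ mh (φ k)) ∧
        (∀ k S : ℕ, ∃ S' : ℕ, S' ∈ 𝓛 k ∧ S ≤ S') ∧ (∀ k : ℕ, ∀ S ∈ 𝓛 k, S₁ (φ k) ≤ S) ∧
        (∃ N : ℕ, 1 ≤ N ∧ ∀ᶠ k in atTop, ∀ S ∈ 𝓛 k, (a k)⁻¹ ≤ (a k * (S : ℝ)) ^ N) ∧
      ∀ (sch : SpeciesScheme (YMSpecies G)), (∀ k, sch.a k = a k) → (∀ k, sch.β k = β (φ k)) →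
        (∀ k, sch.L k ∈ 𝓛 k) →
      ∀ (LS : (k n : ℕ) → SchwartzMap (Fin n → EuclideanSpace ℝ (Fin 4)) ℂ → ℂ),
      (∀ (k n : ℕ) (F : SchwartzMap (Fin n → EuclideanSpace ℝ (Fin 4)) ℂ), LS k n F =
        ∫ U : GaugeConfig 4 (sch.side k) G, ∑ x : Fin n → ↥(Literature.Probability.LatticeModels.box 4 (sch.L k)),
          F (fun i => sch.a k • siteToE ↑(x i)) *
            ∏ i, ((sch.c r.curvature k * sch.a k ^ 4 *
              (r.curvature.F (Literature.MathematicalPhysics.QuantumLattice.configShift (-↑(x i)) (Literature.MathematicalPhysics.QuantumLattice.torusLift (sch.side k) U)) - sch.m r.curvature k) : ℝ) : ℂ)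
          ∂(wilsonMeasure r.ρ (sch.β k))) →
      (∀ k : ℕ, sch.m r.curvature k =
        ∫ U : GaugeConfig 4 (sch.side k) G, r.curvature.F (Literature.MathematicalPhysics.QuantumLattice.torusLift (sch.side k) U) ∂(wilsonMeasure r.ρ (sch.β k))) →
      (∀ k : ℕ, sch.c r.curvature k = (sch.a k ^ 4)⁻¹) →
      (∃ (s : ℕ) (α β' : ℝ), ∀ᶠ k in atTop, ∀ (p : ℕ) (q : Fin p → {q : Fin 4 × Fin 4 // q.1 < q.2})
        (F : SchwartzMap (Fin p → EuclideanSpace ℝ (Fin 4)) ℂ), IsOffDiagonal F →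
        ‖∫ U : GaugeConfig 4 (sch.side k) G, ∑ x : Fin p → ↥(Literature.Probability.LatticeModels.box 4 (sch.L k)),
            F (fun i => sch.a k • siteToE ↑(x i)) *
              ∏ i, ((plaquetteObs r.ρ 0 (q i).1.1 (q i).1.2 (Literature.MathematicalPhysics.QuantumLattice.configShift (-↑(x i)) (Literature.MathematicalPhysics.QuantumLattice.torusLift (sch.side k) U)) -
                wilsonTorusMean r.ρ (sch.β k) (sch.L k) (plaquetteObs r.ρ 0 (q i).1.1 (q i).1.2) : ℝ) : ℂ)
            ∂(wilsonMeasure r.ρ (sch.β k))‖ ≤ α * (p.factorial : ℝ) ^ β' * schwartzNorm (p * s) F) ∧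
      (∃ (f g : SchwartzMap (Fin 1 → EuclideanSpace ℝ (Fin 4)) ℂ)
        (H : SchwartzMap (Fin (1 + 1) → EuclideanSpace ℝ (Fin 4)) ℂ),
        IsTimeOrdered f ∧ IsTimeOrdered g ∧ IsAppendTensorOf H (osAdjoint f) g ∧
          ∃ δ : ℝ, 0 < δ ∧ ∀ᶠ k in atTop, δ ≤ ‖LS k (1 + 1) H‖) ∧
      (∀ R : EuclideanSpace ℝ (Fin 4) ≃ₗᵢ[ℝ] EuclideanSpace ℝ (Fin 4),
        R (EuclideanSpace.single 0 1) =
          (3 / 5 : ℝ) • EuclideanSpace.single 0 1 + (-(4 / 5) : ℝ) • EuclideanSpace.single 1 1 →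
        R (EuclideanSpace.single 1 1) =
          (4 / 5 : ℝ) • EuclideanSpace.single 0 1 + (3 / 5 : ℝ) • EuclideanSpace.single 1 1 →
        R (EuclideanSpace.single 2 1) = EuclideanSpace.single 2 1 →
        R (EuclideanSpace.single 3 1) = EuclideanSpace.single 3 1 →
        ∀ (n : ℕ) (F : SchwartzMap (Fin n → EuclideanSpace ℝ (Fin 4)) ℂ), IsOffDiagonal F →
          Tendsto (fun k : ℕ => LS k n (linActMulti R F) - LS k n F) atTop (𝓝 0))))
    (hQ : (∀ (G : Type) [Group G] [TopologicalSpace G] [IsTopologicalGroup G] [CompactSpace G]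
      [MeasurableSpace G] [BorelSpace G], IsCompactSimpleLieGroup G →
      ∀ (r : LatticeRep G) (sch : SpeciesScheme (YMSpecies G)),
      Tendsto sch.β atTop atTop → UUVB r sch → ND2 r sch → UCL r sch → PolyVolumeGrowth sch →
      AsympTransl r sch → AsympRot r sch →
      (∃ Δ₀ : ℝ, 0 < Δ₀ ∧ HasLatticeMassGap r sch Δ₀) →
      (∃ Δ₁ : ℝ, 0 < Δ₁ ∧ SpeciesScheme.HasCSClustering r (canon r sch) Δ₁) →
      ∃ (f g h f₂ g₂ : ℝ → SchwartzMap (EuclideanSpace ℝ (Fin 4)) ℂ)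
        (F₃ : ℝ → SchwartzMap (Fin 3 → EuclideanSpace ℝ (Fin 4)) ℂ)
        (F₂ : ℝ → SchwartzMap (Fin 2 → EuclideanSpace ℝ (Fin 4)) ℂ) (s : ℝ) (φ : ℕ → ℕ),
        0 < s ∧ StrictMono φ ∧
        (∀ ε : ℝ, 0 < ε → IsTensorOf (F₃ ε) ![f ε, g ε, h ε] ∧ IsOffDiagonal (F₃ ε) ∧
          IsTensorOf (F₂ ε) ![f₂ ε, g₂ ε] ∧ IsOffDiagonal (F₂ ε)) ∧
        (∀ ε : ℝ, 0 < ε → ∀ x : EuclideanSpace ℝ (Fin 4),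
          f ε x = f 1 (ε⁻¹ • x) ∧ g ε x = g 1 (ε⁻¹ • x) ∧ h ε x = h 1 (ε⁻¹ • x) ∧
            f₂ ε x = f₂ 1 (ε⁻¹ • x) ∧ g₂ ε x = g₂ 1 (ε⁻¹ • x)) ∧
        (∀ ε : ℝ, 0 < ε →
          (∀ x : EuclideanSpace ℝ (Fin 4), (f₂ ε x).im = 0 ∧ 0 ≤ (f₂ ε x).re ∧ (g₂ ε x).im = 0 ∧ 0 ≤ (g₂ ε x).re) ∧
            f₂ ε ≠ 0 ∧ g₂ ε ≠ 0 ∧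
            ∃ δ : ℝ, 0 < δ ∧ ∀ x ∈ tsupport (f₂ ε : EuclideanSpace ℝ (Fin 4) → ℂ),
              ∀ y ∈ tsupport (g₂ ε : EuclideanSpace ℝ (Fin 4) → ℂ), δ ≤ dist x y) ∧
        ∀ η : ℝ, 0 < η → ∃ ε₁ : ℝ, 0 < ε₁ ∧ ∀ ε : ℝ, 0 < ε → ε ≤ ε₁ → ∀ᶠ k in atTop,
          |‖curvDistribution r sch (φ k) 3 (F₃ ε)‖ - s * ‖curvDistribution r sch (φ k) 2 (F₂ ε)‖ ^ 2| ≤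
            η * ‖curvDistribution r sch (φ k) 2 (F₂ ε)‖ ^ 2))
    (hP : (∀ (G : Type) [Group G] [TopologicalSpace G] [IsTopologicalGroup G] [CompactSpace G]
      [MeasurableSpace G] [BorelSpace G], IsCompactSimpleLieGroup G →
      ∀ (r : LatticeRep G) (sch : SpeciesScheme (YMSpecies G)),
      Tendsto sch.β atTop atTop → UUVB r sch → ND2 r sch → UCL r sch → PolyVolumeGrowth sch →
      AsympTransl r sch → AsympRot r sch →
      ∀ (f g : SchwartzMap (EuclideanSpace ℝ (Fin 4)) ℂ) (F₂ : SchwartzMap (Fin 2 → EuclideanSpace ℝ (Fin 4)) ℂ),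
        IsTensorOf F₂ ![f, g] → IsOffDiagonal F₂ →
        (∀ x : EuclideanSpace ℝ (Fin 4), (f x).im = 0 ∧ 0 ≤ (f x).re ∧ (g x).im = 0 ∧ 0 ≤ (g x).re) →
        f ≠ 0 → g ≠ 0 →
        (∃ δ : ℝ, 0 < δ ∧ ∀ x ∈ tsupport (f : EuclideanSpace ℝ (Fin 4) → ℂ), ∀ y ∈ tsupport (g : EuclideanSpace ℝ (Fin 4) → ℂ), δ ≤ dist x y) →
        ∃ u : ℝ, 0 < u ∧ ∀ᶠ k in atTop, u ≤ ‖curvDistribution r sch k 2 F₂‖))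
    (hG : IsCompactSimpleLieGroup G)
    (hGap : ∀ r : LatticeRep G,
      (∃ β₀ : ℝ, ∀ β : ℝ, β₀ ≤ β → ∃ m : ℝ, 0 < m ∧ ∃ S₁ : ℕ, ∀ A B : YMSpecies G, ∃ C : ℝ,
        ∀ S n : ℕ, S₁ ≤ S → n ≤ S →
          |latticeConnectedCorr r.ρ β (2 * S + 1) A.F B.F n| ≤ C * Real.exp (-(m * n)))) :
    ∃ (r : LatticeRep G) (sch : SpeciesScheme (YMSpecies G)) (T : OSData (YMSpecies G) 4),
      sch.HasWeakCouplingLimit ∧ IsYangMillsFor r sch T ∧ T.IsNontrivial r.curvature ∧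
        T.IsNonGaussian r.curvature ∧ ∃ Δ > 0, T.HasMassGap Δ ∧ HasLatticeMassGap r sch Δ := by
  obtain ⟨r, huv⟩ := cclgSplit_uvPackage_exists hUV hG
  obtain ⟨β, mh, S₁, K, hL⟩ := cclgSplit_locked_of_core hXi hG r (hGap r)
  have hcrit : Tendsto mh atTop (𝓝 0) := stub_critical hXi G hG r (hGap r) β mh S₁ hL.1 hL.2.1 hL.2.2.2.1
  obtain ⟨sch, φ, Δ₀, hφ, hβ, hΔ₀, ha, hLk, hVS, hCAN, hUU, hND, hCLt, hUCL, hPVG, hEUC, hROT, Δ₁, hΔ₁, hCS⟩ :=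
    huv β mh S₁ K hL hcrit
  have hAF : Tendsto sch.β atTop atTop := by
    rw [show sch.β = fun k => β (φ k) from funext hβ]
    exact hL.1.comp hφ.tendsto_atTop
  have hGAP : HasLatticeMassGap r sch Δ₀ := cclgSplit_gap_of_locked r hL.2.2.2.1 hβ ha hLk
  -- THIS LINE: the skewness floor, frequently, from the quartic law (B) and two-point positivity (C)
  obtain ⟨f₃, g₃, h₃, F₃, hT₃, hO₃, δ, hδ, hfreq⟩ :=
    floor_of_quarticLaw (curvDistribution r sch)
      (hQ G hG r sch hAF hUU hND hUCL hPVG hEUC hROT ⟨Δ₀, hΔ₀, hGAP⟩ ⟨Δ₁, hΔ₁, hCS⟩)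
      (hP G hG r sch hAF hUU hND hUCL hPVG hEUC hROT)
  -- a sub-scheme inside the floor set with convergent products (landed `stub_extract`)
  obtain ⟨ψ, hψ, hψS, hconv⟩ := stub_extract G r sch (by obtain ⟨s, α, β', h⟩ := hUU; exact ⟨s, α, β', h⟩)
    {k | δ ≤ ‖curvDistribution r sch k 3 F₃‖} hfreq
  obtain ⟨hUVB2, hARP2, hND2, hUCL2, hE1⟩ := cclgSplit_pt_package_subScheme r sch hAF hUU hND hUCL hEUC hROT ψ hψ
  have hND3 : ND3 r (subScheme sch ψ hψ) :=
    ⟨f₃, g₃, h₃, F₃, hT₃, hO₃, δ, hδ, Eventually.of_forall fun k => hψS k⟩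
  -- the proved one-field OS packaging of route ParabolicTrajectory
  obtain ⟨T, hYM, hNT, hNGT⟩ := oneFieldOSLegs' G r (subScheme sch ψ hψ) hconv hUVB2 hE1 hARP2 hUCL2 hND2 hND3
  -- the two gaps at the common rate
  have hΔ : 0 < min Δ₀ Δ₁ := cclgSplit_min_pos Δ₀ Δ₁ hΔ₀ hΔ₁
  have hLG : HasLatticeMassGap r (canon r (subScheme sch ψ hψ)) (min Δ₀ Δ₁) :=
    cclgSplit_hasLatticeMassGap_mono r (subScheme sch ψ hψ) (min_le_left _ _) (hasLatticeMassGap_subScheme hGAP ψ hψ)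
  have hCS2 : SpeciesScheme.HasCSClustering r (canon r (subScheme sch ψ hψ)) (min Δ₀ Δ₁) :=
    cclgSplit_hasCSClustering_mono r _ (min_le_right _ _) (cclgSplit_hasCSClustering_canon_subScheme r sch ψ hψ hCS)
  refine ⟨r, canon r (subScheme sch ψ hψ), T, ?_, hYM, hNT, hNGT, min Δ₀ Δ₁, hΔ,
    hYM.hasMassGap_of_hasCSClustering hCS2, hLG⟩
  show Tendsto (canon r (subScheme sch ψ hψ)).β atTop atTop
  exact hAF.comp hψ.tendsto_atTop

/-! ## §4 The skeleton: `ContinuumLegGivenGap_of` concludes the crux BY NAME (primary route + by-name twins) -/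

/-- **`ContinuumLegGivenGap_of`** — the line's skeleton: `XiDiverges` (stmt-QuantumFields-8941, BY NAME as in line
`Sketch`) → ⟨`stub_uvPackageVol`⟩ → ⟨`stub_quarticSkewnessLaw`⟩ → ⟨`stub_twoPointPositivity`⟩ → the crux
(primary route `ComplexCouplingChannel`). [folklore] -/
theorem ContinuumLegGivenGap_of (hXi : DirichletWindow.XiDiverges)
    (hUV : (∀ (G : Type) [Group G] [TopologicalSpace G] [IsTopologicalGroup G] [CompactSpace G]
      [MeasurableSpace G] [BorelSpace G], IsCompactSimpleLieGroup G → ∃ r : LatticeRep G,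
      ∀ (β : ℕ → ℝ) (mh : ℕ → ℝ) (S₁ : ℕ → ℕ) (K : ℝ), Tendsto β atTop atTop → (∀ k, 0 < mh k) → 0 < K →
      (∀ A B : YMSpecies G, ∃ C : ℝ, ∀ k S n : ℕ, S₁ k ≤ S → n ≤ S →
        |latticeConnectedCorr r.ρ (β k) (2 * S + 1) A.F B.F n| ≤ C * Real.exp (-(mh k * n))) →
      (∀ k S₀ : ℕ, ∃ A B : YMSpecies G, ∀ C : ℝ, ∃ S n : ℕ, S₀ ≤ S ∧ n ≤ S ∧
        C * Real.exp (-(K * mh k * n)) < |latticeConnectedCorr r.ρ (β k) (2 * S + 1) A.F B.F n|) →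
      Tendsto mh atTop (𝓝 0) →
      ∃ (a : ℕ → ℝ) (φ : ℕ → ℕ) (Δ₀ : ℝ) (𝓛 : ℕ → Set ℕ),
        (∀ k, 0 < a k) ∧ StrictMono φ ∧ 0 < Δ₀ ∧ (∀ k, Δ₀ * a k ≤ mh (φ k)) ∧
        (∀ k S : ℕ, ∃ S' : ℕ, S' ∈ 𝓛 k ∧ S ≤ S') ∧ (∀ k : ℕ, ∀ S ∈ 𝓛 k, S₁ (φ k) ≤ S) ∧
        (∃ N : ℕ, 1 ≤ N ∧ ∀ᶠ k in atTop, ∀ S ∈ 𝓛 k, (a k)⁻¹ ≤ (a k * (S : ℝ)) ^ N) ∧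
      ∀ (sch : SpeciesScheme (YMSpecies G)), (∀ k, sch.a k = a k) → (∀ k, sch.β k = β (φ k)) →
        (∀ k, sch.L k ∈ 𝓛 k) →
      ∀ (LS : (k n : ℕ) → SchwartzMap (Fin n → EuclideanSpace ℝ (Fin 4)) ℂ → ℂ),
      (∀ (k n : ℕ) (F : SchwartzMap (Fin n → EuclideanSpace ℝ (Fin 4)) ℂ), LS k n F =
        ∫ U : GaugeConfig 4 (sch.side k) G, ∑ x : Fin n → ↥(Literature.Probability.LatticeModels.box 4 (sch.L k)),
          F (fun i => sch.a k • siteToE ↑(x i)) *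
            ∏ i, ((sch.c r.curvature k * sch.a k ^ 4 *
              (r.curvature.F (Literature.MathematicalPhysics.QuantumLattice.configShift (-↑(x i)) (Literature.MathematicalPhysics.QuantumLattice.torusLift (sch.side k) U)) - sch.m r.curvature k) : ℝ) : ℂ)
          ∂(wilsonMeasure r.ρ (sch.β k))) →
      (∀ k : ℕ, sch.m r.curvature k =
        ∫ U : GaugeConfig 4 (sch.side k) G, r.curvature.F (Literature.MathematicalPhysics.QuantumLattice.torusLift (sch.side k) U) ∂(wilsonMeasure r.ρ (sch.β k))) →
      (∀ k : ℕ, sch.c r.curvature k = (sch.a k ^ 4)⁻¹) →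
      (∃ (s : ℕ) (α β' : ℝ), ∀ᶠ k in atTop, ∀ (p : ℕ) (q : Fin p → {q : Fin 4 × Fin 4 // q.1 < q.2})
        (F : SchwartzMap (Fin p → EuclideanSpace ℝ (Fin 4)) ℂ), IsOffDiagonal F →
        ‖∫ U : GaugeConfig 4 (sch.side k) G, ∑ x : Fin p → ↥(Literature.Probability.LatticeModels.box 4 (sch.L k)),
            F (fun i => sch.a k • siteToE ↑(x i)) *
              ∏ i, ((plaquetteObs r.ρ 0 (q i).1.1 (q i).1.2 (Literature.MathematicalPhysics.QuantumLattice.configShift (-↑(x i)) (Literature.MathematicalPhysics.QuantumLattice.torusLift (sch.side k) U)) -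
                wilsonTorusMean r.ρ (sch.β k) (sch.L k) (plaquetteObs r.ρ 0 (q i).1.1 (q i).1.2) : ℝ) : ℂ)
            ∂(wilsonMeasure r.ρ (sch.β k))‖ ≤ α * (p.factorial : ℝ) ^ β' * schwartzNorm (p * s) F) ∧
      (∃ (f g : SchwartzMap (Fin 1 → EuclideanSpace ℝ (Fin 4)) ℂ)
        (H : SchwartzMap (Fin (1 + 1) → EuclideanSpace ℝ (Fin 4)) ℂ),
        IsTimeOrdered f ∧ IsTimeOrdered g ∧ IsAppendTensorOf H (osAdjoint f) g ∧
          ∃ δ : ℝ, 0 < δ ∧ ∀ᶠ k in atTop, δ ≤ ‖LS k (1 + 1) H‖) ∧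
      (∀ R : EuclideanSpace ℝ (Fin 4) ≃ₗᵢ[ℝ] EuclideanSpace ℝ (Fin 4),
        R (EuclideanSpace.single 0 1) =
          (3 / 5 : ℝ) • EuclideanSpace.single 0 1 + (-(4 / 5) : ℝ) • EuclideanSpace.single 1 1 →
        R (EuclideanSpace.single 1 1) =
          (4 / 5 : ℝ) • EuclideanSpace.single 0 1 + (3 / 5 : ℝ) • EuclideanSpace.single 1 1 →
        R (EuclideanSpace.single 2 1) = EuclideanSpace.single 2 1 →
        R (EuclideanSpace.single 3 1) = EuclideanSpace.single 3 1 →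
        ∀ (n : ℕ) (F : SchwartzMap (Fin n → EuclideanSpace ℝ (Fin 4)) ℂ), IsOffDiagonal F →
          Tendsto (fun k : ℕ => LS k n (linActMulti R F) - LS k n F) atTop (𝓝 0))))
    (hQ : (∀ (G : Type) [Group G] [TopologicalSpace G] [IsTopologicalGroup G] [CompactSpace G]
      [MeasurableSpace G] [BorelSpace G], IsCompactSimpleLieGroup G →
      ∀ (r : LatticeRep G) (sch : SpeciesScheme (YMSpecies G)),
      Tendsto sch.β atTop atTop → UUVB r sch → ND2 r sch → UCL r sch → PolyVolumeGrowth sch →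
      AsympTransl r sch → AsympRot r sch →
      (∃ Δ₀ : ℝ, 0 < Δ₀ ∧ HasLatticeMassGap r sch Δ₀) →
      (∃ Δ₁ : ℝ, 0 < Δ₁ ∧ SpeciesScheme.HasCSClustering r (canon r sch) Δ₁) →
      ∃ (f g h f₂ g₂ : ℝ → SchwartzMap (EuclideanSpace ℝ (Fin 4)) ℂ)
        (F₃ : ℝ → SchwartzMap (Fin 3 → EuclideanSpace ℝ (Fin 4)) ℂ)
        (F₂ : ℝ → SchwartzMap (Fin 2 → EuclideanSpace ℝ (Fin 4)) ℂ) (s : ℝ) (φ : ℕ → ℕ),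
        0 < s ∧ StrictMono φ ∧
        (∀ ε : ℝ, 0 < ε → IsTensorOf (F₃ ε) ![f ε, g ε, h ε] ∧ IsOffDiagonal (F₃ ε) ∧
          IsTensorOf (F₂ ε) ![f₂ ε, g₂ ε] ∧ IsOffDiagonal (F₂ ε)) ∧
        (∀ ε : ℝ, 0 < ε → ∀ x : EuclideanSpace ℝ (Fin 4),
          f ε x = f 1 (ε⁻¹ • x) ∧ g ε x = g 1 (ε⁻¹ • x) ∧ h ε x = h 1 (ε⁻¹ • x) ∧
            f₂ ε x = f₂ 1 (ε⁻¹ • x) ∧ g₂ ε x = g₂ 1 (ε⁻¹ • x)) ∧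
        (∀ ε : ℝ, 0 < ε →
          (∀ x : EuclideanSpace ℝ (Fin 4), (f₂ ε x).im = 0 ∧ 0 ≤ (f₂ ε x).re ∧ (g₂ ε x).im = 0 ∧ 0 ≤ (g₂ ε x).re) ∧
            f₂ ε ≠ 0 ∧ g₂ ε ≠ 0 ∧
            ∃ δ : ℝ, 0 < δ ∧ ∀ x ∈ tsupport (f₂ ε : EuclideanSpace ℝ (Fin 4) → ℂ),
              ∀ y ∈ tsupport (g₂ ε : EuclideanSpace ℝ (Fin 4) → ℂ), δ ≤ dist x y) ∧
        ∀ η : ℝ, 0 < η → ∃ ε₁ : ℝ, 0 < ε₁ ∧ ∀ ε : ℝ, 0 < ε → ε ≤ ε₁ → ∀ᶠ k in atTop,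
          |‖curvDistribution r sch (φ k) 3 (F₃ ε)‖ - s * ‖curvDistribution r sch (φ k) 2 (F₂ ε)‖ ^ 2| ≤
            η * ‖curvDistribution r sch (φ k) 2 (F₂ ε)‖ ^ 2))
    (hP : (∀ (G : Type) [Group G] [TopologicalSpace G] [IsTopologicalGroup G] [CompactSpace G]
      [MeasurableSpace G] [BorelSpace G], IsCompactSimpleLieGroup G →
      ∀ (r : LatticeRep G) (sch : SpeciesScheme (YMSpecies G)),
      Tendsto sch.β atTop atTop → UUVB r sch → ND2 r sch → UCL r sch → PolyVolumeGrowth sch →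
      AsympTransl r sch → AsympRot r sch →
      ∀ (f g : SchwartzMap (EuclideanSpace ℝ (Fin 4)) ℂ) (F₂ : SchwartzMap (Fin 2 → EuclideanSpace ℝ (Fin 4)) ℂ),
        IsTensorOf F₂ ![f, g] → IsOffDiagonal F₂ →
        (∀ x : EuclideanSpace ℝ (Fin 4), (f x).im = 0 ∧ 0 ≤ (f x).re ∧ (g x).im = 0 ∧ 0 ≤ (g x).re) →
        f ≠ 0 → g ≠ 0 →
        (∃ δ : ℝ, 0 < δ ∧ ∀ x ∈ tsupport (f : EuclideanSpace ℝ (Fin 4) → ℂ), ∀ y ∈ tsupport (g : EuclideanSpace ℝ (Fin 4) → ℂ), δ ≤ dist x y) →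
        ∃ u : ℝ, 0 < u ∧ ∀ᶠ k in atTop, u ≤ ‖curvDistribution r sch k 2 F₂‖)) :
    ComplexCouplingChannel.ContinuumLegGivenGap := by
  intro G _ _ _ _ hG
  letI : MeasurableSpace G := borel G
  haveI : BorelSpace G := ⟨rfl⟩
  intro hGap
  exact concl_of_stubs hXi hUV hQ hP hG hGap

/-- **The stubs literally compose**: with the three registered stubs plugged in, `XiDiverges` implies the crux (closed
modulo `sorryAx` of `stub_uvPackageVol`, `stub_quarticSkewnessLaw`, `stub_twoPointPositivity` only). [folklore] -/
theorem ContinuumLegGivenGap_of_stubs (hXi : DirichletWindow.XiDiverges) :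
    ComplexCouplingChannel.ContinuumLegGivenGap :=
  ContinuumLegGivenGap_of hXi stub_uvPackageVol stub_quarticSkewnessLawSep stub_twoPointPositivitySep

/-- The seven route declarations of the shared item are one proposition (character-identical bodies). [folklore] -/
theorem convexGribovBody_iff :
    ConvexGribovBody.ContinuumLegGivenGap ↔ ComplexCouplingChannel.ContinuumLegGivenGap := Iff.rfl

/-- (ditto, `SmallCircleAnchor`). [folklore] -/
theorem smallCircleAnchor_iff :
    SmallCircleAnchor.ContinuumLegGivenGap ↔ ComplexCouplingChannel.ContinuumLegGivenGap := Iff.rfl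

/-- (ditto, `HyperbolicRegulator`). [folklore] -/
theorem hyperbolicRegulator_iff :
    HyperbolicRegulator.ContinuumLegGivenGap ↔ ComplexCouplingChannel.ContinuumLegGivenGap := Iff.rfl

/-- (ditto, `ContractibleFibre.WeakCouplingContinuumLeg`). [folklore] -/
theorem contractibleFibre_iff :
    ContractibleFibre.WeakCouplingContinuumLeg ↔ ComplexCouplingChannel.ContinuumLegGivenGap := Iff.rfl

/-- (ditto, `DoublingDefect`). [folklore] -/
theorem doublingDefect_iff :
    DoublingDefect.ContinuumLegGivenGap ↔ ComplexCouplingChannel.ContinuumLegGivenGap := Iff.rfl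

/-- (ditto, `NoiseSynchronisation`). [folklore] -/
theorem noiseSynchronisation_iff :
    NoiseSynchronisation.ContinuumLegGivenGap ↔ ComplexCouplingChannel.ContinuumLegGivenGap := Iff.rfl

/-- By-name twin for route `ConvexGribovBody` (the card's `crux_decl`). [folklore] -/
theorem ConvexGribovBody_ContinuumLegGivenGap_of (hXi : DirichletWindow.XiDiverges) :
    ConvexGribovBody.ContinuumLegGivenGap :=
  convexGribovBody_iff.2 (ContinuumLegGivenGap_of_stubs hXi)

/-- By-name twin for route `SmallCircleAnchor`. [folklore] -/
theorem SmallCircleAnchor_ContinuumLegGivenGap_of (hXi : DirichletWindow.XiDiverges) :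
    SmallCircleAnchor.ContinuumLegGivenGap :=
  smallCircleAnchor_iff.2 (ContinuumLegGivenGap_of_stubs hXi)

/-- By-name twin for route `HyperbolicRegulator`. [folklore] -/
theorem HyperbolicRegulator_ContinuumLegGivenGap_of (hXi : DirichletWindow.XiDiverges) :
    HyperbolicRegulator.ContinuumLegGivenGap :=
  hyperbolicRegulator_iff.2 (ContinuumLegGivenGap_of_stubs hXi)

/-- By-name twin for route `ContractibleFibre` (`WeakCouplingContinuumLeg`). [folklore] -/
theorem ContractibleFibre_WeakCouplingContinuumLeg_of (hXi : DirichletWindow.XiDiverges) :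
    ContractibleFibre.WeakCouplingContinuumLeg :=
  contractibleFibre_iff.2 (ContinuumLegGivenGap_of_stubs hXi)

/-- By-name twin for route `DoublingDefect`. [folklore] -/
theorem DoublingDefect_ContinuumLegGivenGap_of (hXi : DirichletWindow.XiDiverges) :
    DoublingDefect.ContinuumLegGivenGap :=
  doublingDefect_iff.2 (ContinuumLegGivenGap_of_stubs hXi)

/-- By-name twin for route `NoiseSynchronisation`. [folklore] -/
theorem NoiseSynchronisation_ContinuumLegGivenGap_of (hXi : DirichletWindow.XiDiverges) :
    NoiseSynchronisation.ContinuumLegGivenGap :=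
  noiseSynchronisation_iff.2 (ContinuumLegGivenGap_of_stubs hXi)

/-- By-name twin for route `ComplexCouplingChannel` in the `<Route>_<Crux>_of` naming (same term). [folklore] -/
theorem ComplexCouplingChannel_ContinuumLegGivenGap_of (hXi : DirichletWindow.XiDiverges) :
    ComplexCouplingChannel.ContinuumLegGivenGap :=
  ContinuumLegGivenGap_of_stubs hXi

/-! ## §5 Position in the web (for the record; proved read-backs) -/

/-- **B ∧ C give line `Sketch`'s registered window**: under (UVB) the skewness floor they produce is EQUIVALENT to the
NLO skewness window of `stub_skewWindow` (landed `stub_windowOfNG`), so this line is a typed FIRST RUNG of child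
`SkewnessWindowNLO`: it replaces one opaque window by a law (B) plus a piece of OS theory (C). [folklore] -/
theorem skewWindow_of_floor (LS : (k n : ℕ) → SchwartzMap (Fin n → 𝔼) ℂ → ℂ)
    (hUVB : ∃ (s : ℕ) (α β : ℝ), ∀ (n : ℕ) (F : SchwartzMap (Fin n → 𝔼) ℂ), IsOffDiagonal F →
      ∀ᶠ k in atTop, ‖LS k n F‖ ≤ α * (n.factorial : ℝ) ^ β * schwartzNorm (n * s) F)
    (hNG : ∃ (f g h : SchwartzMap 𝔼 ℂ) (F₃ : SchwartzMap (Fin 3 → 𝔼) ℂ),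
      IsTensorOf F₃ ![f, g, h] ∧ IsOffDiagonal F₃ ∧ ∃ δ : ℝ, 0 < δ ∧ ∃ᶠ k in atTop, δ ≤ ‖LS k 3 F₃‖) :
    ∃ (s₃ : ℂ) (φ : ℕ → ℕ) (f g h : ℕ → SchwartzMap 𝔼 ℂ)
      (F₃ : ℕ → SchwartzMap (Fin 3 → 𝔼) ℂ) (w : ℕ → ℝ),
      s₃ ≠ 0 ∧ StrictMono φ ∧ (∀ j, 0 < w j) ∧ (∀ j, IsTensorOf (F₃ j) ![f j, g j, h j] ∧ IsOffDiagonal (F₃ j)) ∧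
        ∀ ε : ℝ, 0 < ε → ∀ᶠ j in atTop, ∀ᶠ k in atTop, ‖LS (φ k) 3 (F₃ j) / (w j : ℂ) - s₃‖ ≤ ε :=
  Summit.QuantumFields.YangMills.Theorems.ContinuumLegGivenGap.stub_windowOfNG LS hUVB hNG

end Summit.QuantumFields.YangMills.Cruxes.ContinuumLegGivenGap.DualitySelectionNloSkewness

end
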